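import Literature.MathematicalPhysics.QuantumFieldTheory.Balaban1983to89.B1Eq324BenfattoEq324Signed
import Literature.MathematicalPhysics.QuantumFieldTheory.Balaban1983to89.B1Eq324BenfattoSect5Eq515
import Literature.MathematicalPhysics.QuantumFieldTheory.Balaban1983to89.B1Eq324BenfattoKernelOfPrecision
import Literature.MathematicalPhysics.QuantumFieldTheory.Balaban1983to89.B1Eq324CumulantTaylor
import HarnessLib

/-!
# `Balaban1983to89.B1Eq324BenfattoClassRescale` — THE MEMBER NORMALISATION `1/γ_A ≤ ½` BY RESCALING THE FIELD
([BenfattoEtAl1978] Lemma (4.5)–(4.7) p. 152 «E z_Δ² = ½»; the class of [Balaban1985BackgroundPropagators] Sect. E p. 428: field scaling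
`z ↦ λz` of the data `(μ, H^a_J, χ̂^I_b)`, of the Gaussian `μ_K`, of the member `(Λ, A, K)`, and of [Balaban1982Higgs1] (3.24) in `η`-currency)

statement-level companion of a published source with citation tags; every declaration here is a theorem; nothing here is
a claim about the Yang–Mills mass gap

WHY THIS MODULE (cell `pub-ymgap`, seat `dag-n08-b` gen 14, INTENT-1; node N08 [Balaban1985UV3]; the [BenfattoEtAl1978] source chain behind the
(α)-row `h324c`).  The class (4.7)/(4.6) knits (`…KernelSect5Ineq47Class.ineq47_class_of_pack`, `…KernelSect5Ineq46Class`, the `∃`-knit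
`…KernelSect5ClassBasicLemma`) carry print's normalisation «E z_Δ² = ½» as the DISPLAYED member row `hhalf : 1/γ_A ≤ 1/2`
(`…KernelSect5PartFieldRows.partKernel_self_le_half`: the part kernels' variances are `≤ 1/γ_A ≤ ½`).  A member presented by an
instantiation (seat n08-d's located memo `N08-CLASS-ENTRY-LOCATED-g14.md` §2 (iv): «`1/γ_A ≤ 1/2` — a NORMALISATION of the member: rescale the
field if `γ_A < 2`»; seat n08-c's word W4) has SOME coercivity constant `γ_A > 0`, not `≥ 2`.  This file types the normalisation once:
the field scaling `z = λ z′` maps the member `(Λ, A, K)` to the member `(Λ, λ²A, λ⁻²K)` (coercivity `λ²γ_A`, which is `≥ 2` for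
`λ² ≥ 2/γ_A`; Combes–Thomas and growth rows scale by `λ²` resp. `1`; the guard, `J_c/γ_A` and `VM/(γ_A − J_c)` are INVARIANT), the data
`(H^a_J, χ̂^I_b)` to `(H^{a_λ}_J, χ̂^I_{b/λ})` with `a_λ(p; Δ; n) = λ^{Σnᵢ}·a(p; Δ; n)` (so `coefSup ≤ (max 1 λ)^D·coefSup`), the Gaussian
`μ_K` to `μ_{λ⁻²K}` (`(μ_K).map (λ⁻¹•) = μ_{λ⁻²K}`, any index set), leaving the cut-off exponential moment and the truncated expectations
UNCHANGED; and since seat n08-d's measure-free `…Eq324Signed.eq324_of_sandwich_consts` is parametric in the threshold constant `b₀` and the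
coefficient constant `c`, the two-sided sandwich delivered by the knit for the NORMALISED member at cut-off `p(b₀,p₀,η)/λ = p(b₀/λ,p₀,η)` yields
[Balaban1982Higgs1] (3.24) for the ORIGINAL member at the record's cut-off `p(b₀,p₀,η)` with only `η₀, C` moved — which is what the
(α)-socket's unscaled presentation (seat n08-w4's `…RowClassSocket`, CHECK A: scalings `λ_b = 1` on `I`) consumes.

WHAT IS PROVED (standard axioms; no `sorry`; no definition — the scaled coefficient family is written as the lambda
`fun p Δ n => c ^ (∑ i, n i) * a p Δ n` throughout).
* §1 DATA (measure-generic, any `μ` on `Q₀ → ℝ`): `hamiltonian_smul` (`H^a_J(c•z) = H^{a_c}_J(z)`), `scaleCoef_scaleCoef_inv` (`(a_c)_{c⁻¹} = a`),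
  ★ `coefSup_scale_le` (`coefSup(a_c) ≤ (max 1 |c|)^D·coefSup(a)`), `mem_smallFieldSet_smul_iff` (`c•z ∈ χ̂^I_b ↔ z ∈ χ̂^I_{b/c}`, `c > 0`),
  `cutoffBoltzmann_hamiltonian_smul`, ★ `integral_cutoffBoltzmann_hamiltonian_map_smul` (`∫Π_Δχ̂^I_b e^{H^a_J} d(μ∘(c•)⁻¹) = ∫Π_Δχ̂^I_{b/c} e^{H^{a_c}_J} dμ`),
  `truncatedExp_hamiltonian_map_smul`, ★ `cumulantSum_hamiltonian_map_smul` (`Ê^T_{μ∘(c•)⁻¹}(H^a_J) = Ê^T_μ(H^{a_c}_J)`, any `c`).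
* §2 GAUSSIAN (any index type): `isPosSemidefKernel_const_mul`, ★★ `gaussianFieldOfKernel_map_const_mul`
  (`(μ_K).map (ω ↦ c·ω) = μ_{c²K}`, by uniqueness `CurvatureGaussianField.eq_gaussianFieldOfKernel_of_isGaussianProcess`),
  `integral_gaussianFieldOfKernel_comp_const_mul`.
* §3 THE SCALED MEMBER `(Λ, r•A, r⁻¹•K)`, `r > 0`: `inv_smul_eq` (`(r•A)⁻¹ = r⁻¹•A⁻¹`), ★ `kernel_smul` (the `hK` convention transported),
  `symm_smul`, ★ `coercive_smul` (`rγ_A`), `rowBound_smul` (`A`-weighted rows scale by `r`), `guard_smul_iff`, `ratio_smul`, `contraction_smul`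
  (the invariants), ★ `half_of_smul` (`1/(rγ_A) ≤ 1/2` for `2/γ_A ≤ r`), `gaussianFieldOfKernel_member_smul` (`μ_{r⁻¹K} = (μ_K).map (√r⁻¹•)`).
* §4 ★★ `pFun_div`, ★★★ `eq324_of_scaled_sandwich_consts` — [Balaban1982Higgs1] (3.24) in `η`-currency for the ORIGINAL data `(μ, a, p(b₀,p₀,η))`
  from the two-sided sandwich for the SCALED data `(μ.map (λ⁻¹•), a_λ, p(b₀,p₀,η)/λ)` (`λ > 0`; `η₀, C` from `(t, b*, S, ρ₃, b₀/λ, p₀, σ, (max 1 λ)^D c, κ)`),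
  ★★ `eq324_kernel_of_scaled_sandwich_consts` (the same at `μ = μ_K`, the sandwich stated for `μ_{λ⁻²K}` — the Gaussian of the member `(Λ, λ²A)`),
  ★★ `eq324Shape_of_scaled_sandwich_consts` (the same in `B1Sect3Statements.Eq324` shape — the currency of seat n08-w4's (α)-sockets);
  and the bare identities ★★ `integral_cutoffBoltzmann_scaled_eq` / `cumulantSum_scaled_eq` / `truncatedExp_scaled_eq` (+ `_kernel` Gaussian instances):
  the scaled instance's cut-off exponential moment and perturbative sum ARE the original ones, so (3.24) in any output shape transfers verbatim.
HONEST SCOPE.  Elementary change of variables + bookkeeping; the class, its rows and the normalisation are OURS (print has `Λ = ℤ^d`,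
`E z² = ½`); no generalised Basic Lemma is stated or proved here (the knit is seat n08-c's `…KernelSect5ClassBasicLemma`); the IDENT of
[Balaban1985UV3]'s step block with a class member is NOT commissioned and NOT claimed; count-neutral for N08; nothing about d = 4, the
continuum, OS axioms, a mass gap or the Clay problem.
-/

noncomputable section

open MeasureTheory ProbabilityTheory Finset Matrix
open scoped BigOperators

namespace Literature.MathematicalPhysics.QuantumFieldTheory.Balaban1983to89.B1Eq324BenfattoClassRescale

open _root_.MeasureTheory _root_.ProbabilityTheory
open Literature.MathematicalPhysics.QuantumFieldTheory
open Literature.MathematicalPhysics.QuantumFieldTheory.Balaban1983to89.B1Eq324BenfattoLemma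
open Literature.MathematicalPhysics.QuantumFieldTheory.Balaban1983to89.B1Eq324BenfattoSpecialisation (coefSup_nonneg abs_coef_le_coefSup)
open Literature.MathematicalPhysics.QuantumFieldTheory.Balaban1983to89.B1Eq324BenfattoSect5Eq515 (measurable_hamiltonian)
open Literature.MathematicalPhysics.QuantumFieldTheory.Balaban1983to89.B1Eq324BenfattoEq324Signed (eq324_of_sandwich_consts)
open Literature.MathematicalPhysics.QuantumFieldTheory.Balaban1983to89.B1Eq324BenfattoClassAppendixC (posDef_of_coercive)
open Literature.MathematicalPhysics.QuantumFieldTheory.Balaban1983to89.B1Eq324BenfattoKernelOfPrecision (isPosSemidefKernel_kernel)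
open Literature.MathematicalPhysics.QuantumFieldTheory.Balaban1983to89.B1Eq324CumulantTaylor (eq324_iff_abs_log_sub_le)

variable {d : ℕ}

/-! ## §1  The data under the field scaling `z ↦ c•z` (measure-generic) -/

section Data

variable {s D : ℕ} {ϰ : ℝ}

/-- **`H^a_J(c•z) = H^{a_c}_J(z)`** with `a_c(p; Δ; n) = c^{Σnᵢ}·a(p; Δ; n)`: each monomial `Π z_{Δᵢ}^{nᵢ}` picks up `c^{Σnᵢ}`.
[cite: BenfattoEtAl1978, (4.5) p.152] -/
theorem hamiltonian_smul (a : Coef d) (J : Finset (B1Eq324BenfattoLemma.Site d)) (c : ℝ) (z : B1Eq324BenfattoLemma.Site d → ℝ) :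
    hamiltonian s D ϰ a J (fun x => c * z x) = hamiltonian s D ϰ (fun p Δ n => c ^ (∑ i, n i) * a p Δ n) J z := by
  unfold hamiltonian
  refine Finset.sum_congr rfl fun p _ => Finset.sum_congr rfl fun Δ _ => Finset.sum_congr rfl fun n _ => ?_
  have hprod : ∏ i, (c * z (Δ i : B1Eq324BenfattoLemma.Site d)) ^ n i = c ^ (∑ i, n i) * ∏ i, z (Δ i : B1Eq324BenfattoLemma.Site d) ^ n i := by
    simp only [mul_pow, Finset.prod_mul_distrib, Finset.prod_pow_eq_pow_sum]
  rw [hprod]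
  ring

/-- **Scaling twice**: `(a_c)_{c′} = a_{c′c}` — in particular `(a_c)_{c⁻¹} = a` for `c ≠ 0`. [cite: BenfattoEtAl1978, (4.5) p.152] -/
theorem scaleCoef_scaleCoef_inv (a : Coef d) {c : ℝ} (hc : c ≠ 0) :
    (fun (p : ℕ) (Δ : Fin p → B1Eq324BenfattoLemma.Site d) (n : Fin p → ℕ) => c⁻¹ ^ (∑ i, n i) * (c ^ (∑ i, n i) * a p Δ n)) = a := by
  funext p Δ n
  rw [← mul_assoc, ← mul_pow, inv_mul_cancel₀ hc, one_pow, one_mul]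

/-- **`coefSup(a_c) ≤ (max 1 |c|)^D · coefSup(a)`**: on the index range of (4.5) the exponents satisfy `Σnᵢ ≤ D`, so `|c|^{Σnᵢ} ≤ (max 1 |c|)^D`.
[cite: BenfattoEtAl1978, (4.5) p.152] -/
theorem coefSup_scale_le (s D : ℕ) (a : Coef d) (J : Finset (B1Eq324BenfattoLemma.Site d)) (c : ℝ) :
    coefSup s D (fun p Δ n => c ^ (∑ i, n i) * a p Δ n) J ≤ (max 1 |c|) ^ D * coefSup s D a J := by
  have hA := coefSup_nonneg s D a J
  have hM : 0 ≤ (max 1 |c|) ^ D * coefSup s D a J := mul_nonneg (pow_nonneg (le_trans zero_le_one (le_max_left _ _)) _) hA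
  unfold coefSup
  refine csSup_le ⟨0, Set.mem_insert 0 _⟩ ?_
  rintro r hr
  rcases Set.mem_insert_iff.mp hr with rfl | ⟨p, hp, Δ, n, hn, rfl⟩
  · exact hM
  · have hsum : ∑ i, n i ≤ D := (mem_admissible.mp hn).2
    rw [abs_mul, abs_pow]
    calc |c| ^ (∑ i, n i) * |a p (fun i => (Δ i : B1Eq324BenfattoLemma.Site d)) n|
        ≤ (max 1 |c|) ^ D * |a p (fun i => (Δ i : B1Eq324BenfattoLemma.Site d)) n| := by
          refine mul_le_mul_of_nonneg_right ?_ (abs_nonneg _)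
          exact (pow_le_pow_left₀ (abs_nonneg c) (le_max_right 1 |c|) _).trans
            (pow_le_pow_right₀ (le_max_left 1 |c|) hsum)
      _ ≤ (max 1 |c|) ^ D * coefSup s D a J :=
          mul_le_mul_of_nonneg_left (abs_coef_le_coefSup s D a J hp Δ hn) (pow_nonneg (le_trans zero_le_one (le_max_left _ _)) _)

/-- **The small-field event under scaling**: for `c > 0`, `c•z ∈ {Π_Δχ̂^I_b}` iff `z ∈ {Π_Δχ̂^I_{b/c}}` (every threshold `b(1 + d(I,Δ))` is divided by `c`).
[cite: BenfattoEtAl1978, p.152 and (A.1) p.161] -/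
theorem mem_smallFieldSet_smul_iff (I : Finset (B1Eq324BenfattoLemma.Site d)) (b : ℝ) {c : ℝ} (hc : 0 < c)
    (z : B1Eq324BenfattoLemma.Site d → ℝ) :
    (fun x => c * z x) ∈ smallFieldSet I b ↔ z ∈ smallFieldSet I (b / c) := by
  simp only [smallFieldSet, Set.mem_setOf_eq, abs_mul, abs_of_pos hc]
  refine forall_congr' fun x => ?_
  rw [div_mul_eq_mul_div, le_div_iff₀ hc, mul_comm]

/-- **The cut-off Boltzmann factor under scaling**: `(Π_Δχ̂^I_b e^{H^a_J})(c•z) = (Π_Δχ̂^I_{b/c} e^{H^{a_c}_J})(z)` for `c > 0`.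
[cite: BenfattoEtAl1978, (4.6)–(4.7) p.152] -/
theorem cutoffBoltzmann_hamiltonian_smul (a : Coef d) (J I : Finset (B1Eq324BenfattoLemma.Site d)) (b : ℝ) {c : ℝ} (hc : 0 < c)
    (z : B1Eq324BenfattoLemma.Site d → ℝ) :
    cutoffBoltzmann (hamiltonian s D ϰ a J) I b (fun x => c * z x) =
      cutoffBoltzmann (hamiltonian s D ϰ (fun p Δ n => c ^ (∑ i, n i) * a p Δ n) J) I (b / c) z := by
  simp only [cutoffBoltzmann]
  by_cases hz : z ∈ smallFieldSet I (b / c)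
  · rw [Set.indicator_of_mem hz, Set.indicator_of_mem ((mem_smallFieldSet_smul_iff I b hc z).mpr hz), hamiltonian_smul]
  · rw [Set.indicator_of_notMem hz, Set.indicator_of_notMem (fun h => hz ((mem_smallFieldSet_smul_iff I b hc z).mp h))]

/-- kernel: the field scaling `z ↦ c•z` is measurable on the product space. [folklore] -/
private theorem measurable_smul_field (c : ℝ) :
    Measurable fun (z : B1Eq324BenfattoLemma.Site d → ℝ) (x : B1Eq324BenfattoLemma.Site d) => c * z x :=
  measurable_pi_lambda _ fun x => measurable_const.mul (measurable_pi_apply x)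

/-- kernel: `Π_Δχ̂^I_b e^{H^a_J}` is measurable. [folklore] -/
private theorem measurable_cutoffBoltzmann_hamiltonian' (a : Coef d) (J I : Finset (B1Eq324BenfattoLemma.Site d)) (b : ℝ) :
    Measurable (cutoffBoltzmann (hamiltonian s D ϰ a J) I b) := by
  rw [cutoffBoltzmann]
  exact Measurable.indicator (Real.measurable_exp.comp (measurable_hamiltonian J)) (measurableSet_smallFieldSet I b)

/-- **The cut-off exponential moment under the scaled law**: `∫Π_Δχ̂^I_b e^{H^a_J} d(μ.map (c•)) = ∫Π_Δχ̂^I_{b/c} e^{H^{a_c}_J} dμ` (`c > 0`, any measure `μ`).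
[cite: BenfattoEtAl1978, (4.6)–(4.7) p.152] -/
theorem integral_cutoffBoltzmann_hamiltonian_map_smul (μ : Measure (B1Eq324BenfattoLemma.Site d → ℝ)) (a : Coef d)
    (J I : Finset (B1Eq324BenfattoLemma.Site d)) (b : ℝ) {c : ℝ} (hc : 0 < c) :
    ∫ z, cutoffBoltzmann (hamiltonian s D ϰ a J) I b z ∂(μ.map fun (z : B1Eq324BenfattoLemma.Site d → ℝ) (x : B1Eq324BenfattoLemma.Site d) => c * z x) =
      ∫ z, cutoffBoltzmann (hamiltonian s D ϰ (fun p Δ n => c ^ (∑ i, n i) * a p Δ n) J) I (b / c) z ∂μ := by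
  rw [integral_map (measurable_smul_field c).aemeasurable (measurable_cutoffBoltzmann_hamiltonian' a J I b).aestronglyMeasurable]
  exact integral_congr_ae (Filter.Eventually.of_forall fun z => cutoffBoltzmann_hamiltonian_smul a J I b hc z)

/-- **The truncated expectations under the scaled law**: `Ê^T_{μ.map (c•)}(H^a_J; k) = Ê^T_μ(H^{a_c}_J; k)` (any `c`, any measure; the moments of
`H^a_J` under the image law are those of `H^a_J ∘ (c•) = H^{a_c}_J`). [cite: BenfattoEtAl1978, (2.7) p.147, (4.5) p.152] -/
theorem truncatedExp_hamiltonian_map_smul (μ : Measure (B1Eq324BenfattoLemma.Site d → ℝ)) (a : Coef d)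
    (J : Finset (B1Eq324BenfattoLemma.Site d)) (c : ℝ) (k : ℕ) :
    truncatedExp (μ.map fun (z : B1Eq324BenfattoLemma.Site d → ℝ) (x : B1Eq324BenfattoLemma.Site d) => c * z x) (hamiltonian s D ϰ a J) k =
      truncatedExp μ (hamiltonian s D ϰ (fun p Δ n => c ^ (∑ i, n i) * a p Δ n) J) k := by
  unfold truncatedExp
  congr 1
  funext r
  rw [integral_map (measurable_smul_field c).aemeasurable ((measurable_hamiltonian J).pow_const r).aestronglyMeasurable]
  exact integral_congr_ae (Filter.Eventually.of_forall fun z => by simp only [hamiltonian_smul])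

/-- **The bracket of (4.6)–(4.7) under the scaled law**: `Σ_{k≤t}Ê^T_{μ.map (c•)}(H^a_J; k)/k! = Σ_{k≤t}Ê^T_μ(H^{a_c}_J; k)/k!`.
[cite: BenfattoEtAl1978, (4.6)–(4.7) p.152] -/
theorem cumulantSum_hamiltonian_map_smul (μ : Measure (B1Eq324BenfattoLemma.Site d → ℝ)) (a : Coef d)
    (J : Finset (B1Eq324BenfattoLemma.Site d)) (c : ℝ) (t : ℕ) :
    cumulantSum (μ.map fun (z : B1Eq324BenfattoLemma.Site d → ℝ) (x : B1Eq324BenfattoLemma.Site d) => c * z x) (hamiltonian s D ϰ a J) t =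
      cumulantSum μ (hamiltonian s D ϰ (fun p Δ n => c ^ (∑ i, n i) * a p Δ n) J) t := by
  unfold cumulantSum
  simp only [truncatedExp_hamiltonian_map_smul]

end Data

/-! ## §2  The Gaussian field under scaling (any index type) -/

section Gaussian

variable {ι : Type*} [DecidableEq ι]

omit [DecidableEq ι] in
/-- **A non-negative multiple of a positive-semidefinite kernel is positive semidefinite** (`c²K` for the scaled field).
[cite: BenfattoEtAl1978, (1.1) p.144 (class form; ours)] -/
theorem isPosSemidefKernel_const_mul {K : ι → ι → ℝ} (hK : IsPosSemidefKernel K) {r : ℝ} (hr : 0 ≤ r) :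
    IsPosSemidefKernel fun s t => r * K s t := by
  intro I
  have h : covGram (fun s t => r * K s t) I = r • covGram K I := by
    ext s t
    simp only [covGram_apply, Matrix.smul_apply, smul_eq_mul]
  rw [h]
  exact (hK I).smul hr

omit [DecidableEq ι] in
/-- kernel: scaling of configurations is measurable (general index type). [folklore] -/
private theorem measurable_const_mul_config (c : ℝ) : Measurable fun (ω : ι → ℝ) (s : ι) => c * ω s :=
  measurable_pi_lambda _ fun s => measurable_const.mul (measurable_pi_apply s)

/-- **PUSH-FORWARD OF A GAUSSIAN FIELD UNDER FIELD SCALING** — `(μ_K).map (ω ↦ c·ω) = μ_{c²K}` for every positive-semidefinite kernel `K` on any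
index set and every real `c`: the image is a centred Gaussian law (the coordinate process is `c` times a Gaussian process) with covariance
`c²K`, hence equals `μ_{c²K}` by uniqueness (`CurvatureGaussianField.eq_gaussianFieldOfKernel_of_isGaussianProcess`; compare seat n08-c's
`…CondKernelGeneric.gaussianFieldOfKernel_map_reindex`). [cite: BenfattoEtAl1978, (1.1) p.144 (class form; ours)] -/
theorem gaussianFieldOfKernel_map_const_mul {K : ι → ι → ℝ} (hK : IsPosSemidefKernel K) (c : ℝ) :
    (gaussianFieldOfKernel K).map (fun (ω : ι → ℝ) (s : ι) => c * ω s) = gaussianFieldOfKernel (fun s t => c ^ 2 * K s t) := by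
  have hKc : IsPosSemidefKernel fun s t => c ^ 2 * K s t := isPosSemidefKernel_const_mul hK (sq_nonneg c)
  haveI : IsProbabilityMeasure (gaussianFieldOfKernel K) := isProbabilityMeasure_gaussianFieldOfKernel hK
  have hTm := measurable_const_mul_config (ι := ι) c
  haveI : IsProbabilityMeasure ((gaussianFieldOfKernel K).map fun (ω : ι → ℝ) (s : ι) => c * ω s) :=
    Measure.isProbabilityMeasure_map hTm.aemeasurable
  -- (i) the coordinate process of the image is Gaussian: it is `c •` the original process
  have hG : IsGaussianProcess (fun (s : ι) (z : ι → ℝ) => z s)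
      ((gaussianFieldOfKernel K).map fun (ω : ι → ℝ) (s : ι) => c * ω s) := by
    refine ⟨fun I => ⟨?_⟩⟩
    have hrm : Measurable (fun z : ι → ℝ => I.restrict z) := Finset.measurable_restrict I
    rw [Measure.map_map hrm hTm]
    have h := ((isGaussianProcess_eval_gaussianFieldOfKernel hK).smul fun _ => c).hasGaussianLaw I
    exact h.isGaussian_map
  -- (ii) mean zero, (iii) covariance `c²K`
  have hm : ∀ s, ∫ z, z s ∂(gaussianFieldOfKernel K).map (fun (ω : ι → ℝ) (s : ι) => c * ω s) = 0 := by
    intro s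
    rw [integral_map hTm.aemeasurable (measurable_pi_apply s).aestronglyMeasurable]
    change ∫ ω : ι → ℝ, c * ω s ∂gaussianFieldOfKernel K = 0
    rw [integral_const_mul, integral_eval_gaussianFieldOfKernel hK s, mul_zero]
  have hc : ∀ s t, cov[fun z : ι → ℝ => z s, fun z => z t;
      (gaussianFieldOfKernel K).map (fun (ω : ι → ℝ) (s : ι) => c * ω s)] = c ^ 2 * K s t := by
    intro s t
    rw [covariance_map (measurable_pi_apply s).aestronglyMeasurable (measurable_pi_apply t).aestronglyMeasurable
      hTm.aemeasurable]
    change cov[fun ω : ι → ℝ => c * ω s, fun ω => c * ω t; gaussianFieldOfKernel K] = _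
    rw [covariance_const_mul_left, covariance_const_mul_right, covariance_eval_gaussianFieldOfKernel hK s t]
    ring
  exact eq_gaussianFieldOfKernel_of_isGaussianProcess hKc hG hm hc

/-- **Integrals transform covariantly under field scaling**: `∫ F(c·ω) dμ_K = ∫ F dμ_{c²K}` for measurable `F`.
[cite: BenfattoEtAl1978, (1.1) p.144 (class form; ours)] -/
theorem integral_gaussianFieldOfKernel_comp_const_mul {K : ι → ι → ℝ} (hK : IsPosSemidefKernel K) (c : ℝ)
    {F : (ι → ℝ) → ℝ} (hF : Measurable F) :
    ∫ ω, F (fun s => c * ω s) ∂gaussianFieldOfKernel K = ∫ z, F z ∂gaussianFieldOfKernel (fun s t => c ^ 2 * K s t) := by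
  rw [← gaussianFieldOfKernel_map_const_mul hK c, integral_map (measurable_const_mul_config c).aemeasurable hF.aestronglyMeasurable]

end Gaussian


/-! ## §3  The scaled member `(Λ, r•A, r⁻¹•K)` -/

section Member

variable {Λ : Finset (B1Eq324BenfattoLemma.Site d)} {A : Matrix Λ Λ ℝ}

/-- **`(r•A)⁻¹ = r⁻¹•A⁻¹`** for an invertible precision and `r ≠ 0`. [cite: Balaban1985BackgroundPropagators, Sect. E p.428 (class form; ours)] -/
theorem inv_smul_eq (hA : IsUnit A.det) {r : ℝ} (hr : r ≠ 0) : (r • A)⁻¹ = r⁻¹ • (A⁻¹ : Matrix Λ Λ ℝ) := by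
  refine Matrix.inv_eq_left_inv ?_
  rw [smul_mul_assoc, mul_smul_comm, smul_smul, inv_mul_cancel₀ hr, one_smul, Matrix.nonsing_inv_mul _ hA]

/-- kernel: a symmetric coercive matrix has invertible determinant. [folklore] -/
private theorem isUnit_det_of_coercive (hAs : ∀ e e', A e e' = A e' e) {γA : ℝ} (hγA0 : 0 < γA)
    (hγA : ∀ x : Λ → ℝ, γA * ∑ e, x e ^ 2 ≤ ∑ e, ∑ e', A e e' * x e * x e') : IsUnit A.det :=
  (Matrix.isUnit_iff_isUnit_det A).mp (posDef_of_coercive hAs hγA0 hγA).isUnit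

/-- ★ **THE SCALED MEMBER'S KERNEL**: if `K` is the zero-extended `A⁻¹` (the `hK` convention of the class road) and `A` is symmetric
`γ_A`-coercive, then `r⁻¹K` is the zero-extended `(r•A)⁻¹` (`r ≠ 0`). [cite: Balaban1985BackgroundPropagators, Sect. E p.428 (class form; ours)] -/
theorem kernel_smul {K : B1Eq324BenfattoLemma.Site d → B1Eq324BenfattoLemma.Site d → ℝ}
    (hK : ∀ x y, K x y = if h : x ∈ Λ ∧ y ∈ Λ then (A⁻¹ : Matrix Λ Λ ℝ) ⟨x, h.1⟩ ⟨y, h.2⟩ else 0)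
    (hAs : ∀ e e', A e e' = A e' e) {γA : ℝ} (hγA0 : 0 < γA)
    (hγA : ∀ x : Λ → ℝ, γA * ∑ e, x e ^ 2 ≤ ∑ e, ∑ e', A e e' * x e * x e') {r : ℝ} (hr : r ≠ 0) :
    ∀ x y, r⁻¹ * K x y = if h : x ∈ Λ ∧ y ∈ Λ then ((r • A)⁻¹ : Matrix Λ Λ ℝ) ⟨x, h.1⟩ ⟨y, h.2⟩ else 0 := by
  intro x y
  rw [hK x y, inv_smul_eq (isUnit_det_of_coercive hAs hγA0 hγA) hr]
  split_ifs with h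
  · simp only [Matrix.smul_apply, smul_eq_mul]
  · exact mul_zero _

/-- The scaled precision is symmetric. [cite: Balaban1985BackgroundPropagators, Sect. E p.428 (class form; ours)] -/
theorem symm_smul (hAs : ∀ e e', A e e' = A e' e) (r : ℝ) : ∀ e e', (r • A) e e' = (r • A) e' e := fun e e' => by
  simp only [Matrix.smul_apply, hAs e e']

/-- ★ **The scaled precision is `rγ_A`-coercive** (`r ≥ 0`). [cite: Balaban1985BackgroundPropagators, Sect. E p.428 (class form; ours)] -/
theorem coercive_smul {γA : ℝ} (hγA : ∀ x : Λ → ℝ, γA * ∑ e, x e ^ 2 ≤ ∑ e, ∑ e', A e e' * x e * x e') {r : ℝ} (hr : 0 ≤ r) :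
    ∀ x : Λ → ℝ, r * γA * ∑ e, x e ^ 2 ≤ ∑ e, ∑ e', (r • A) e e' * x e * x e' := by
  intro x
  have h : ∑ e, ∑ e', (r • A) e e' * x e * x e' = r * ∑ e, ∑ e', A e e' * x e * x e' := by
    simp only [Matrix.smul_apply, smul_eq_mul, Finset.mul_sum]
    exact Finset.sum_congr rfl fun e _ => Finset.sum_congr rfl fun e' _ => by ring
  rw [h, mul_assoc]
  exact mul_le_mul_of_nonneg_left (hγA x) hr

/-- **The `A`-weighted rows scale by `r`** (`r ≥ 0`): the Combes–Thomas row `J_c`, the growth rows `M`, `M₂` of the scaled member are `rJ_c`, `rM`, `rM₂`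
(any non-negative weight). [cite: Balaban1985BackgroundPropagators, (1.16)–(1.18) p.180, Sect. E p.428 (class form; ours)] -/
theorem rowBound_smul {wgt : Λ → Λ → ℝ} {Jc : ℝ} (hJ : ∀ e : Λ, ∑ e' : Λ, |A e e'| * wgt e e' ≤ Jc) {r : ℝ} (hr : 0 ≤ r) :
    ∀ e : Λ, ∑ e' : Λ, |(r • A) e e'| * wgt e e' ≤ r * Jc := by
  intro e
  have h : ∑ e' : Λ, |(r • A) e e'| * wgt e e' = r * ∑ e' : Λ, |A e e'| * wgt e e' := by
    simp only [Matrix.smul_apply, smul_eq_mul, abs_mul, abs_of_nonneg hr, Finset.mul_sum]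
    exact Finset.sum_congr rfl fun e' _ => by ring
  rw [h]
  exact mul_le_mul_of_nonneg_left (hJ e) hr

/-- **The guard is scale invariant**: `J_c/(cosh θw − 1) < γ_A` ⇒ `rJ_c/(cosh θw − 1) < rγ_A` (`r > 0`). [cite: BenfattoEtAl1978, §5 p.154 (class form; ours)] -/
theorem guard_smul {Jc γA X : ℝ} (h : Jc / X < γA) {r : ℝ} (hr : 0 < r) : r * Jc / X < r * γA := by
  rw [mul_div_assoc]
  exact mul_lt_mul_of_pos_left h hr

/-- `rJ_c < rγ_A` from `J_c < γ_A` (`r > 0`). [cite: Balaban1985BackgroundPropagators, Sect. E p.428 (class form; ours)] -/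
theorem lt_smul {Jc γA : ℝ} (h : Jc < γA) {r : ℝ} (hr : 0 < r) : r * Jc < r * γA :=
  mul_lt_mul_of_pos_left h hr

/-- **The ratio `J_c/γ_A` is scale invariant**: `(rJ_c)/(rγ_A) = J_c/γ_A` (`r ≠ 0`). [cite: BenfattoEtAl1978, §5 p.154 (class form; ours)] -/
theorem ratio_smul (Jc γA : ℝ) {r : ℝ} (hr : r ≠ 0) : r * Jc / (r * γA) = Jc / γA :=
  mul_div_mul_left Jc γA hr

/-- **The contraction row is scale invariant**: `V·(rM)/(rγ_A − rJ_c)·γ = V·M/(γ_A − J_c)·γ` (`r ≠ 0`). [cite: BenfattoEtAl1978, §5 p.156 (class form; ours)] -/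
theorem contraction_smul (V M γA Jc γ : ℝ) {r : ℝ} (hr : r ≠ 0) :
    V * (r * M) / (r * γA - r * Jc) * γ = V * M / (γA - Jc) * γ := by
  rw [← mul_sub, show V * (r * M) = r * (V * M) by ring, mul_div_mul_left _ _ hr]

/-- **`1/(rγ_A) ≤ 1/γ_A` for `r ≥ 1`** (every row with `1/γ_A` on the small side transfers to the scaled member).
[cite: BenfattoEtAl1978, Appendix C (C.4) p.164 (class form; ours)] -/
theorem one_div_smul_le {γA : ℝ} (hγA0 : 0 < γA) {r : ℝ} (hr : 1 ≤ r) : 1 / (r * γA) ≤ 1 / γA :=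
  one_div_le_one_div_of_le hγA0 (le_mul_of_one_le_left hγA0.le hr)

/-- ★ **THE NORMALISATION**: `1/(rγ_A) ≤ ½` as soon as `2/γ_A ≤ r` — the knits' displayed `hhalf` for the scaled member.
[cite: BenfattoEtAl1978, Lemma p.152 «E z_Δ² = ½»; Appendix C (C.4) p.164 (class form; ours)] -/
theorem half_of_smul {γA : ℝ} (hγA0 : 0 < γA) {r : ℝ} (hr : 2 / γA ≤ r) : 1 / (r * γA) ≤ 1 / 2 :=
  one_div_le_one_div_of_le two_pos ((div_le_iff₀ hγA0).mp hr)

/-- **A normalising field scale exists**: for `γ_A > 0` the scale `λ := max 1 √(2/γ_A)` has `λ ≥ 1` and `1/(λ²γ_A) ≤ ½`.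
[cite: BenfattoEtAl1978, Lemma p.152 «E z_Δ² = ½» (class form; ours)] -/
theorem exists_normalising_scale {γA : ℝ} (hγA0 : 0 < γA) : ∃ lam : ℝ, 1 ≤ lam ∧ 1 / (lam ^ 2 * γA) ≤ 1 / 2 := by
  refine ⟨max 1 (Real.sqrt (2 / γA)), le_max_left _ _, half_of_smul hγA0 ?_⟩
  calc 2 / γA = Real.sqrt (2 / γA) ^ 2 := (Real.sq_sqrt (div_nonneg zero_le_two hγA0.le)).symm
    _ ≤ (max 1 (Real.sqrt (2 / γA))) ^ 2 := pow_le_pow_left₀ (Real.sqrt_nonneg _) (le_max_right _ _) 2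

/-- **The Gaussian of the scaled member**: `μ_{r⁻¹K} = (μ_K).map (ω ↦ (√r)⁻¹·ω)` for `r > 0` and positive-semidefinite `K` (§2 at `c = (√r)⁻¹`).
[cite: BenfattoEtAl1978, (1.1) p.144 (class form; ours)] -/
theorem gaussianFieldOfKernel_member_smul {K : B1Eq324BenfattoLemma.Site d → B1Eq324BenfattoLemma.Site d → ℝ} (hK : IsPosSemidefKernel K)
    {r : ℝ} (hr : 0 < r) :
    gaussianFieldOfKernel (fun x y => r⁻¹ * K x y) =
      (gaussianFieldOfKernel K).map fun (ω : B1Eq324BenfattoLemma.Site d → ℝ) (x : B1Eq324BenfattoLemma.Site d) => (Real.sqrt r)⁻¹ * ω x := by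
  rw [gaussianFieldOfKernel_map_const_mul hK]
  congr 1
  funext x y
  rw [inv_pow, Real.sq_sqrt hr.le]

/-- The zero-extended kernel of a symmetric coercive precision is positive semidefinite (J1 `isPosSemidefKernel_kernel` at `posDef_of_coercive`).
[cite: BenfattoEtAl1978, (1.1) p.144 (class form; ours)] -/
theorem isPosSemidefKernel_of_member {K : B1Eq324BenfattoLemma.Site d → B1Eq324BenfattoLemma.Site d → ℝ}
    (hK : ∀ x y, K x y = if h : x ∈ Λ ∧ y ∈ Λ then (A⁻¹ : Matrix Λ Λ ℝ) ⟨x, h.1⟩ ⟨y, h.2⟩ else 0)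
    (hAs : ∀ e e', A e e' = A e' e) {γA : ℝ} (hγA0 : 0 < γA)
    (hγA : ∀ x : Λ → ℝ, γA * ∑ e, x e ^ 2 ≤ ∑ e, ∑ e', A e e' * x e * x e') : IsPosSemidefKernel K :=
  isPosSemidefKernel_kernel hK (posDef_of_coercive hAs hγA0 hγA)

end Member

/-! ## §4  [Balaban1982Higgs1] (3.24) in `η`-currency for the ORIGINAL data from the sandwich for the SCALED data -/

section Transfer

/-- ★★ **The threshold scales with `b₀`**: `p(b₀/λ, p₀, η) = p(b₀, p₀, η)/λ`. [cite: Balaban1985UV3, (7) p.257] -/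
theorem pFun_div (b₀ p₀ η lam : ℝ) : B10.pFun (b₀ / lam) p₀ η = B10.pFun b₀ p₀ η / lam := by
  unfold B10.pFun
  rw [div_mul_eq_mul_div]

/-- ★★ **THE SCALED DATA HAVE THE SAME CUT-OFF EXPONENTIAL MOMENT**: `∫Π_Δχ̂^I_{b/λ} e^{H^{a_λ}_J} d(μ.map (λ⁻¹•)) = ∫Π_Δχ̂^I_b e^{H^a_J} dμ` (`λ > 0`,
any measure) — so ANY statement about the scaled instance's integral is a statement about the original one.
[cite: BenfattoEtAl1978, (4.6)–(4.7) p.152] -/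
theorem integral_cutoffBoltzmann_scaled_eq (μ : Measure ((Fin d → ℤ) → ℝ)) {s D : ℕ} {ϰ : ℝ} (a : Coef d)
    (J I : Finset (Fin d → ℤ)) (b : ℝ) {lam : ℝ} (hlam : 0 < lam) :
    ∫ z, cutoffBoltzmann (hamiltonian s D ϰ (fun p Δ n => lam ^ (∑ i, n i) * a p Δ n) J) I (b / lam) z
        ∂(μ.map fun (z : (Fin d → ℤ) → ℝ) (x : Fin d → ℤ) => lam⁻¹ * z x) =
      ∫ z, cutoffBoltzmann (hamiltonian s D ϰ a J) I b z ∂μ := by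
  rw [integral_cutoffBoltzmann_hamiltonian_map_smul μ _ J I _ (inv_pos.mpr hlam), scaleCoef_scaleCoef_inv a hlam.ne',
    div_inv_eq_mul, div_mul_cancel₀ _ hlam.ne']

/-- ★★ **THE SCALED DATA HAVE THE SAME PERTURBATIVE SUM**: `Σ_{k≤t}Ê^T_{μ.map (λ⁻¹•)}(H^{a_λ}_J;k)/k! = Σ_{k≤t}Ê^T_μ(H^a_J;k)/k!` (`λ ≠ 0`, any measure).
[cite: BenfattoEtAl1978, (2.7) p.147, (4.6)–(4.7) p.152] -/
theorem cumulantSum_scaled_eq (μ : Measure ((Fin d → ℤ) → ℝ)) {s D : ℕ} {ϰ : ℝ} (a : Coef d) (J : Finset (Fin d → ℤ))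
    {lam : ℝ} (hlam : lam ≠ 0) (t : ℕ) :
    cumulantSum (μ.map fun (z : (Fin d → ℤ) → ℝ) (x : Fin d → ℤ) => lam⁻¹ * z x)
        (hamiltonian s D ϰ (fun p Δ n => lam ^ (∑ i, n i) * a p Δ n) J) t = cumulantSum μ (hamiltonian s D ϰ a J) t := by
  rw [cumulantSum_hamiltonian_map_smul μ _ J lam⁻¹ t, scaleCoef_scaleCoef_inv a hlam]

/-- `Ê^T_{μ.map (λ⁻¹•)}(H^{a_λ}_J; k) = Ê^T_μ(H^a_J; k)` order by order (`λ ≠ 0`). [cite: BenfattoEtAl1978, (2.7) p.147] -/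
theorem truncatedExp_scaled_eq (μ : Measure ((Fin d → ℤ) → ℝ)) {s D : ℕ} {ϰ : ℝ} (a : Coef d) (J : Finset (Fin d → ℤ))
    {lam : ℝ} (hlam : lam ≠ 0) (k : ℕ) :
    truncatedExp (μ.map fun (z : (Fin d → ℤ) → ℝ) (x : Fin d → ℤ) => lam⁻¹ * z x)
        (hamiltonian s D ϰ (fun p Δ n => lam ^ (∑ i, n i) * a p Δ n) J) k = truncatedExp μ (hamiltonian s D ϰ a J) k := by
  rw [truncatedExp_hamiltonian_map_smul μ _ J lam⁻¹ k, scaleCoef_scaleCoef_inv a hlam]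

/-- ★★★ **(3.24) FOR THE ORIGINAL DATA FROM THE SANDWICH FOR THE SCALED DATA** — for every field scale `λ > 0`, threshold constants `b₀ > 0`,
`p₀ > 2/3`, coupling power `σ > 0`, `c ≥ 0`, truncation order `t`, error constants `S ≥ 0`, `ρ₃ > 0` and exponent `0 < κ < σ(t+1)`:
`∃ η₀ ∈ (0,1], C ≥ 0` (from `(t, b*, S, ρ₃, b₀/λ, p₀, σ, (max 1 λ)^D·c, κ)` — seat n08-d's `…Eq324Signed.eq324_of_sandwich_consts` at the scaled
threshold and coefficient constants) such that for every `η ∈ (0, η₀]`: `b* < p(η)/λ` and, for EVERY measure `μ` and every `(s, I, J, a)` with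
`coefSup ≤ c·η^σ`, the two-sided sandwich for the SCALED data `(μ.map (λ⁻¹•), a_λ, p(η)/λ)` in `|I|·errTerm S ρ (coefSup a_λ) (p(η)/λ) t`
currency implies `0 < ∫Π_Δχ̂^I_{p(η)}e^{H^a_J}dμ` and `|log ∫Π_Δχ̂^I_{p(η)}e^{H^a_J}dμ − Σ_{k≤t}Ê^T_μ(H^a_J;k)/k!| ≤ C·η^κ·|I|` for the ORIGINAL data.
Proof: `coefSup a_λ ≤ (max 1 λ)^D c η^σ` (§1), the sandwich IS the hypothesis of `eq324_of_sandwich_consts` at the scaled instance, and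
its conclusion is rewritten by `∫Π_Δχ̂^I_{p/λ}e^{H^{a_λ}_J}d(μ.map (λ⁻¹•)) = ∫Π_Δχ̂^I_{p}e^{H^a_J}dμ`, `Ê^T_{μ.map (λ⁻¹•)}(H^{a_λ}_J) = Ê^T_μ(H^a_J)` (§1 at
`c = λ⁻¹`, `(a_λ)_{λ⁻¹} = a`). [cite: Balaban1982Higgs1, (3.24) p.616; BenfattoEtAl1978, Lemma (4.5)–(4.7) p.152; Balaban1985UV3, (7) p.257] -/
theorem eq324_of_scaled_sandwich_consts {t D : ℕ} {ϰ bstar S ρ₁ ρ₂ ρ₃ ρ₄ b₀ p₀ σ c κ lam : ℝ} (hlam : 0 < lam)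
    (hS : 0 ≤ S) (hρ₃ : 0 < ρ₃) (hb₀ : 0 < b₀) (hp₀ : 2 / 3 < p₀) (hσ : 0 < σ) (hc : 0 ≤ c) (hκ : 0 < κ) (hκσ : κ < σ * (t + 1)) :
    ∃ η₀ C : ℝ, 0 < η₀ ∧ η₀ ≤ 1 ∧ 0 ≤ C ∧ ∀ η : ℝ, 0 < η → η ≤ η₀ →
      bstar < B10.pFun b₀ p₀ η / lam ∧
      ∀ (μ : Measure ((Fin d → ℤ) → ℝ)) (s : ℕ) (I J : Finset (Fin d → ℤ)) (a : Coef d), coefSup s D a J ≤ c * η ^ σ →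
        Real.exp (cumulantSum (μ.map fun (z : (Fin d → ℤ) → ℝ) (x : Fin d → ℤ) => lam⁻¹ * z x)
                (hamiltonian s D ϰ (fun p Δ n => lam ^ (∑ i, n i) * a p Δ n) J) t -
              (I.card : ℝ) * errTerm S ρ₁ ρ₂ ρ₃ ρ₄ (coefSup s D (fun p Δ n => lam ^ (∑ i, n i) * a p Δ n) J) (B10.pFun b₀ p₀ η / lam) t) ≤
            ∫ z, cutoffBoltzmann (hamiltonian s D ϰ (fun p Δ n => lam ^ (∑ i, n i) * a p Δ n) J) I (B10.pFun b₀ p₀ η / lam) z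
              ∂(μ.map fun (z : (Fin d → ℤ) → ℝ) (x : Fin d → ℤ) => lam⁻¹ * z x) →
        ∫ z, cutoffBoltzmann (hamiltonian s D ϰ (fun p Δ n => lam ^ (∑ i, n i) * a p Δ n) J) I (B10.pFun b₀ p₀ η / lam) z
              ∂(μ.map fun (z : (Fin d → ℤ) → ℝ) (x : Fin d → ℤ) => lam⁻¹ * z x) ≤
            Real.exp (cumulantSum (μ.map fun (z : (Fin d → ℤ) → ℝ) (x : Fin d → ℤ) => lam⁻¹ * z x)
                (hamiltonian s D ϰ (fun p Δ n => lam ^ (∑ i, n i) * a p Δ n) J) t +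
              (I.card : ℝ) * errTerm S ρ₁ ρ₂ ρ₃ ρ₄ (coefSup s D (fun p Δ n => lam ^ (∑ i, n i) * a p Δ n) J) (B10.pFun b₀ p₀ η / lam) t) →
        0 < ∫ z, cutoffBoltzmann (hamiltonian s D ϰ a J) I (B10.pFun b₀ p₀ η) z ∂μ ∧
          |Real.log (∫ z, cutoffBoltzmann (hamiltonian s D ϰ a J) I (B10.pFun b₀ p₀ η) z ∂μ) -
              cumulantSum μ (hamiltonian s D ϰ a J) t| ≤ C * η ^ κ * I.card := by
  have hc' : 0 ≤ (max 1 lam) ^ D * c := mul_nonneg (pow_nonneg (le_trans zero_le_one (le_max_left _ _)) _) hc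
  obtain ⟨η₀, C, hη₀, hη₀1, hC, hE⟩ :=
    eq324_of_sandwich_consts (d := d) (D := D) (ϰ := ϰ) (bstar := bstar) (ρ₁ := ρ₁) (ρ₂ := ρ₂) (ρ₄ := ρ₄) (t := t)
      hS hρ₃ (div_pos hb₀ hlam) hp₀ hσ hc' hκ hκσ
  simp only [pFun_div] at hE
  refine ⟨η₀, C, hη₀, hη₀1, hC, fun η hη hηle => ?_⟩
  obtain ⟨hb, hη⟩ := hE η hη hηle
  refine ⟨hb, fun μ s I J a hA hlow hup => ?_⟩
  -- the scaled coefficient bound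
  have hA' : coefSup s D (fun p Δ n => lam ^ (∑ i, n i) * a p Δ n) J ≤ (max 1 lam) ^ D * c * η ^ σ := by
    refine (coefSup_scale_le s D a J lam).trans ?_
    rw [abs_of_pos hlam, mul_assoc]
    exact mul_le_mul_of_nonneg_left hA (pow_nonneg (le_trans zero_le_one (le_max_left _ _)) _)
  have key := hη (μ.map fun (z : (Fin d → ℤ) → ℝ) (x : Fin d → ℤ) => lam⁻¹ * z x) s I J _ hA' hlow hup
  -- undo the scaling in the conclusion
  rw [integral_cutoffBoltzmann_scaled_eq μ a J I _ hlam, cumulantSum_scaled_eq μ a J hlam.ne' t] at key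
  exact key

/-- ★★ **THE SAME AT THE GAUSSIAN OF A MEMBER** — `μ = μ_K` (`K` positive semidefinite), the sandwich stated for the Gaussian `μ_{λ⁻²K}` of the
SCALED member `(Λ, λ²A)` (§2: `(μ_K).map (λ⁻¹•) = μ_{λ⁻²K}`; its rows are §3 at `r = λ²`, its normalisation `1/(λ²γ_A) ≤ ½` is `half_of_smul`):
the class knit's output for the normalised member at cut-off `p(η)/λ` gives (3.24) for `μ_K` at the record's cut-off `p(η)`.
[cite: Balaban1982Higgs1, (3.24) p.616; BenfattoEtAl1978, Lemma (4.5)–(4.7) p.152; Balaban1985BackgroundPropagators, Sect. E p.428 (class form; ours)] -/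
theorem eq324_kernel_of_scaled_sandwich_consts {K : (Fin d → ℤ) → (Fin d → ℤ) → ℝ} (hK : IsPosSemidefKernel K)
    {t D : ℕ} {ϰ bstar S ρ₁ ρ₂ ρ₃ ρ₄ b₀ p₀ σ c κ lam : ℝ} (hlam : 0 < lam)
    (hS : 0 ≤ S) (hρ₃ : 0 < ρ₃) (hb₀ : 0 < b₀) (hp₀ : 2 / 3 < p₀) (hσ : 0 < σ) (hc : 0 ≤ c) (hκ : 0 < κ) (hκσ : κ < σ * (t + 1)) :
    ∃ η₀ C : ℝ, 0 < η₀ ∧ η₀ ≤ 1 ∧ 0 ≤ C ∧ ∀ η : ℝ, 0 < η → η ≤ η₀ →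
      bstar < B10.pFun b₀ p₀ η / lam ∧
      ∀ (s : ℕ) (I J : Finset (Fin d → ℤ)) (a : Coef d), coefSup s D a J ≤ c * η ^ σ →
        Real.exp (cumulantSum (gaussianFieldOfKernel fun x y => (lam ^ 2)⁻¹ * K x y)
                (hamiltonian s D ϰ (fun p Δ n => lam ^ (∑ i, n i) * a p Δ n) J) t -
              (I.card : ℝ) * errTerm S ρ₁ ρ₂ ρ₃ ρ₄ (coefSup s D (fun p Δ n => lam ^ (∑ i, n i) * a p Δ n) J) (B10.pFun b₀ p₀ η / lam) t) ≤
            ∫ z, cutoffBoltzmann (hamiltonian s D ϰ (fun p Δ n => lam ^ (∑ i, n i) * a p Δ n) J) I (B10.pFun b₀ p₀ η / lam) z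
              ∂(gaussianFieldOfKernel fun x y => (lam ^ 2)⁻¹ * K x y) →
        ∫ z, cutoffBoltzmann (hamiltonian s D ϰ (fun p Δ n => lam ^ (∑ i, n i) * a p Δ n) J) I (B10.pFun b₀ p₀ η / lam) z
              ∂(gaussianFieldOfKernel fun x y => (lam ^ 2)⁻¹ * K x y) ≤
            Real.exp (cumulantSum (gaussianFieldOfKernel fun x y => (lam ^ 2)⁻¹ * K x y)
                (hamiltonian s D ϰ (fun p Δ n => lam ^ (∑ i, n i) * a p Δ n) J) t +
              (I.card : ℝ) * errTerm S ρ₁ ρ₂ ρ₃ ρ₄ (coefSup s D (fun p Δ n => lam ^ (∑ i, n i) * a p Δ n) J) (B10.pFun b₀ p₀ η / lam) t) →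
        0 < ∫ z, cutoffBoltzmann (hamiltonian s D ϰ a J) I (B10.pFun b₀ p₀ η) z ∂gaussianFieldOfKernel K ∧
          |Real.log (∫ z, cutoffBoltzmann (hamiltonian s D ϰ a J) I (B10.pFun b₀ p₀ η) z ∂gaussianFieldOfKernel K) -
              cumulantSum (gaussianFieldOfKernel K) (hamiltonian s D ϰ a J) t| ≤ C * η ^ κ * I.card := by
  obtain ⟨η₀, C, hη₀, hη₀1, hC, hE⟩ :=
    eq324_of_scaled_sandwich_consts (d := d) (t := t) (D := D) (ϰ := ϰ) (bstar := bstar) (S := S) (ρ₁ := ρ₁) (ρ₂ := ρ₂)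
      (ρ₃ := ρ₃) (ρ₄ := ρ₄) hlam hS hρ₃ hb₀ hp₀ hσ hc hκ hκσ
  refine ⟨η₀, C, hη₀, hη₀1, hC, fun η hη hηle => ?_⟩
  obtain ⟨hb, hη⟩ := hE η hη hηle
  refine ⟨hb, fun s I J a hA hlow hup => ?_⟩
  have hmap : (gaussianFieldOfKernel K).map (fun (z : (Fin d → ℤ) → ℝ) (x : Fin d → ℤ) => lam⁻¹ * z x) =
      gaussianFieldOfKernel fun x y => (lam ^ 2)⁻¹ * K x y := by
    rw [gaussianFieldOfKernel_map_const_mul hK lam⁻¹, inv_pow]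
  have key := hη (gaussianFieldOfKernel K) s I J a hA
  rw [hmap] at key
  exact key hlow hup

/-- **The Gaussian instances**: `∫Π_Δχ̂^I_{b/λ} e^{H^{a_λ}_J} dμ_{λ⁻²K} = ∫Π_Δχ̂^I_b e^{H^a_J} dμ_K` and
`Σ_{k≤t}Ê^T_{μ_{λ⁻²K}}(H^{a_λ}_J;k)/k! = Σ_{k≤t}Ê^T_{μ_K}(H^a_J;k)/k!` (`λ > 0`, `K` positive semidefinite) — so [Balaban1982Higgs1] (3.24) in
ANY output shape (e.g. seat n08-d's `…KernelEq324` at threshold constant `b₀/λ`) for the normalised member `(Λ, λ²A)` and the scaled data reads,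
character for character, as (3.24) for `(Λ, A)` and the original data at `b₀`. [cite: Balaban1982Higgs1, (3.24) p.616; BenfattoEtAl1978, (4.6)–(4.7) p.152] -/
theorem integral_cutoffBoltzmann_scaled_kernel_eq {K : (Fin d → ℤ) → (Fin d → ℤ) → ℝ} (hK : IsPosSemidefKernel K)
    {s D : ℕ} {ϰ : ℝ} (a : Coef d) (J I : Finset (Fin d → ℤ)) (b : ℝ) {lam : ℝ} (hlam : 0 < lam) :
    ∫ z, cutoffBoltzmann (hamiltonian s D ϰ (fun p Δ n => lam ^ (∑ i, n i) * a p Δ n) J) I (b / lam) z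
        ∂(gaussianFieldOfKernel fun x y => (lam ^ 2)⁻¹ * K x y) =
      ∫ z, cutoffBoltzmann (hamiltonian s D ϰ a J) I b z ∂gaussianFieldOfKernel K := by
  rw [← integral_cutoffBoltzmann_scaled_eq (gaussianFieldOfKernel K) a J I b hlam, gaussianFieldOfKernel_map_const_mul hK lam⁻¹, inv_pow]

/-- (cumulant half of the previous entry) [cite: Balaban1982Higgs1, (3.24) p.616; BenfattoEtAl1978, (2.7) p.147] -/
theorem cumulantSum_scaled_kernel_eq {K : (Fin d → ℤ) → (Fin d → ℤ) → ℝ} (hK : IsPosSemidefKernel K)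
    {s D : ℕ} {ϰ : ℝ} (a : Coef d) (J : Finset (Fin d → ℤ)) {lam : ℝ} (hlam : 0 < lam) (t : ℕ) :
    cumulantSum (gaussianFieldOfKernel fun x y => (lam ^ 2)⁻¹ * K x y)
        (hamiltonian s D ϰ (fun p Δ n => lam ^ (∑ i, n i) * a p Δ n) J) t =
      cumulantSum (gaussianFieldOfKernel K) (hamiltonian s D ϰ a J) t := by
  rw [← cumulantSum_scaled_eq (gaussianFieldOfKernel K) a J hlam.ne' t, gaussianFieldOfKernel_map_const_mul hK lam⁻¹, inv_pow]

/-- kernel: `∫Π_Δχ̂^I_b e^{H} dμ = ∫_{χ̂^I_b} e^{H} dμ` (the indicator-weighted Boltzmann factor as a set integral). [folklore] -/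
private theorem integral_cutoffBoltzmann_eq_setIntegral'' (μ : Measure ((Fin d → ℤ) → ℝ)) (H : ((Fin d → ℤ) → ℝ) → ℝ)
    (I : Finset (Fin d → ℤ)) (b : ℝ) :
    ∫ z, cutoffBoltzmann H I b z ∂μ = ∫ z in smallFieldSet I b, Real.exp (H z) ∂μ := by
  simp only [cutoffBoltzmann]
  exact integral_indicator (measurableSet_smallFieldSet I b)

/-- ★★ **THE SAME IN `Eq324` SHAPE** (the currency of seat n08-w4's (α)-sockets `…AlphaEq324RowClassSocket.eq324Row_of_sandwich_consts` /
`…RowCumLetterModel`): from the sandwich for the SCALED data, `Eq324 (∫_{χ̂^I_{p(η)}} e^{H^a_J} dμ) (n ↦ Ê^T_μ(H^a_J; n)) t C η κ |I|` for the ORIGINAL data —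
so the socket's `_gk_vol` budget layer applies unchanged on top. [cite: Balaban1982Higgs1, (3.24) p.616; BenfattoEtAl1978, Lemma (4.5)–(4.7) p.152, Remark 4 p.153] -/
theorem eq324Shape_of_scaled_sandwich_consts {t D : ℕ} {ϰ bstar S ρ₁ ρ₂ ρ₃ ρ₄ b₀ p₀ σ c κ lam : ℝ} (hlam : 0 < lam)
    (hS : 0 ≤ S) (hρ₃ : 0 < ρ₃) (hb₀ : 0 < b₀) (hp₀ : 2 / 3 < p₀) (hσ : 0 < σ) (hc : 0 ≤ c) (hκ : 0 < κ) (hκσ : κ < σ * (t + 1)) :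
    ∃ η₀ C : ℝ, 0 < η₀ ∧ η₀ ≤ 1 ∧ 0 ≤ C ∧ ∀ η : ℝ, 0 < η → η ≤ η₀ →
      bstar < B10.pFun b₀ p₀ η / lam ∧
      ∀ (μ : Measure ((Fin d → ℤ) → ℝ)) (s : ℕ) (I J : Finset (Fin d → ℤ)) (a : Coef d), coefSup s D a J ≤ c * η ^ σ →
        Real.exp (cumulantSum (μ.map fun (z : (Fin d → ℤ) → ℝ) (x : Fin d → ℤ) => lam⁻¹ * z x)
                (hamiltonian s D ϰ (fun p Δ n => lam ^ (∑ i, n i) * a p Δ n) J) t -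
              (I.card : ℝ) * errTerm S ρ₁ ρ₂ ρ₃ ρ₄ (coefSup s D (fun p Δ n => lam ^ (∑ i, n i) * a p Δ n) J) (B10.pFun b₀ p₀ η / lam) t) ≤
            ∫ z, cutoffBoltzmann (hamiltonian s D ϰ (fun p Δ n => lam ^ (∑ i, n i) * a p Δ n) J) I (B10.pFun b₀ p₀ η / lam) z
              ∂(μ.map fun (z : (Fin d → ℤ) → ℝ) (x : Fin d → ℤ) => lam⁻¹ * z x) →
        ∫ z, cutoffBoltzmann (hamiltonian s D ϰ (fun p Δ n => lam ^ (∑ i, n i) * a p Δ n) J) I (B10.pFun b₀ p₀ η / lam) z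
              ∂(μ.map fun (z : (Fin d → ℤ) → ℝ) (x : Fin d → ℤ) => lam⁻¹ * z x) ≤
            Real.exp (cumulantSum (μ.map fun (z : (Fin d → ℤ) → ℝ) (x : Fin d → ℤ) => lam⁻¹ * z x)
                (hamiltonian s D ϰ (fun p Δ n => lam ^ (∑ i, n i) * a p Δ n) J) t +
              (I.card : ℝ) * errTerm S ρ₁ ρ₂ ρ₃ ρ₄ (coefSup s D (fun p Δ n => lam ^ (∑ i, n i) * a p Δ n) J) (B10.pFun b₀ p₀ η / lam) t) →
        B1Sect3Statements.Eq324 (∫ z in smallFieldSet I (B10.pFun b₀ p₀ η), Real.exp (hamiltonian s D ϰ a J z) ∂μ)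
          (fun n => truncatedExp μ (hamiltonian s D ϰ a J) n) t C η κ I.card := by
  obtain ⟨η₀, C, hη₀, hη₀1, hC, hE⟩ :=
    eq324_of_scaled_sandwich_consts (d := d) (t := t) (D := D) (ϰ := ϰ) (bstar := bstar) (S := S) (ρ₁ := ρ₁) (ρ₂ := ρ₂)
      (ρ₃ := ρ₃) (ρ₄ := ρ₄) hlam hS hρ₃ hb₀ hp₀ hσ hc hκ hκσ
  refine ⟨η₀, C, hη₀, hη₀1, hC, fun η hη hηle => ?_⟩
  obtain ⟨hb, hη⟩ := hE η hη hηle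
  refine ⟨hb, fun μ s I J a hA hlow hup => ?_⟩
  obtain ⟨hpos, habs⟩ := hη μ s I J a hA hlow hup
  rw [integral_cutoffBoltzmann_eq_setIntegral''] at hpos habs
  rw [eq324_iff_abs_log_sub_le hpos]
  simpa only [cumulantSum] using habs

end Transfer


end Literature.MathematicalPhysics.QuantumFieldTheory.Balaban1983to89.B1Eq324BenfattoClassRescale
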